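import Mathlib
import Summits.NavierStokesRegularity.FluidComputer.BorderedEigenpairFromSections
import Summits.NavierStokesRegularity.FluidComputer.ResolventFromSections

/-!
# The pairing hypothesis `hpair` FROM SECTIONS (diagonal / Hilbert-basis setting)
(profile-cert-3 g6, cell `ns-blowup`, 2026-08-26)

HONEST FRAMING (human rulings D-0035/D-0074): nothing here is a claim about Navier–Stokes
blow-up. WHAT THIS IS NOT: not NS evidence. MODEL lane bookkeeping about the FORMAT of the F5
certificates of GROUP B (`CertificateAbcSpectrum*` eigenpair rows, `CertificateAbcResolvent*`
non-resonance rows) and of GROUP A's X0 chain. No certificate, number or census word is moved.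

The END-TO-END theorems `BorderedEigenpairFromSections.certified_eigenpair_of_sections_nested`
(p465285), `ResolventFromSections.resolvent_inverse_of_sections` (p466288) and instab4's
`SkewCutGalerkinTailForm.not_eigenvalue_of_structure` keep ONE structural input in operator
form, the strain-type PAIRING bound `hpair : ∀ w (∈ U_Kᗮ), Re ⟪T w, S₀ w⟫ ≤ s ‖S₀ w‖²`
(`S₀ = diag(d)`, `⟪b i, T b j⟫ = t_ij`). What a basis seat gets out of the model (instab4's
`AbcLatticePairingBound.abs_re_sum_inner_crossForm_le`, a bound on FINITELY SUPPORTED lattice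
families, i.e. on Galerkin SECTIONS) is, after writing `c = Σ_{i∈F} e_i v_i` in an orthonormal
class basis with first-order matrix `a_ij` (§3), the statement
`hA : ∀ F e, Re Σ_{i∈F} Σ_{j∈F} conj(e_i) a_ij e_j ≤ s Σ_{i∈F} |e_i|²` — every finite section of
the first-order matrix has real numerical range `≤ s`. §2 proves `hA ⇒ hpair` for EVERY bounded
`T` with `⟪b i, T b j⟫ = t_ij = a_ij d_j` and EVERY `w ∈ H`: on a truncation
`w_F = Σ_{i∈F} ⟪b i, w⟫ b_i` both sides are the finite expressions of `hA` with
`e_i = d_i ⟪b i, w⟫` (§1: linearity of `T`, `S₀ b_i = d_i b_i`, orthonormality); `w_F → w`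
(`HilbertBasis.hasSum_repr`); `w ↦ s‖S₀ w‖² − Re⟪T w, S₀ w⟫` is continuous. No graph-domain
density, no band structure, no Schur data. §3 is the generic lattice-side Gram bookkeeping
(pointwise-linear `X` on orthonormal finitely-summable families `v_i : K → E`,
`a_ij = Σ'_k ⟪v_i(k), X(v_j)(k)⟫`) producing `hA`; §4 restates the two GROUP-B END-TO-END
theorems with `hpair` replaced by `hA`.

Still model-specific: the class-II Craya / orbit-pair families `v_i` and the identification of
the certifiers' matrices (definitions; instab3 `CrayaFrames`), instab4's bound itself (kernel),
the transcribed numbers (certifier audit). Mathlib + the files named; no new definitions.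
bears_on LADDER-NS N5 / Z4-a(1)(2); evidence-only for `EpisodeBase`
(stmt-NavierStokesRegularity-19179). [folklore] throughout.
-/

noncomputable section

namespace Summit.NavierStokesRegularity.FluidComputer.BorderedEigenpairPairingSections

open Filter Topology Submodule
open scoped InnerProductSpace ComplexConjugate

variable {𝕜 H : Type*} [RCLike 𝕜] [NormedAddCommGroup H] [InnerProductSpace 𝕜 H] [CompleteSpace H]
variable {ι : Type*} (b : HilbertBasis ι 𝕜 H) [DecidableEq ι]

/-! ## §1 Truncations and their images in coordinates -/

omit [CompleteSpace H] [DecidableEq ι] in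
/-- `⟪b i, T (Σ_{j∈F} c_j b_j)⟫ = Σ_{j∈F} ⟪b i, T b_j⟫ c_j` (linearity of `T`). -/
theorem inner_basis_map_sum_smul (T : H →L[𝕜] H) (F : Finset ι) (c : ι → 𝕜) (i : ι) :
    ⟪b i, T (∑ j ∈ F, c j • b j)⟫_𝕜 = ∑ j ∈ F, ⟪b i, T (b j)⟫_𝕜 * c j := by
  rw [map_sum, inner_sum]
  refine Finset.sum_congr rfl fun j _ => ?_
  rw [map_smul, inner_smul_right, mul_comm]

omit [CompleteSpace H] [DecidableEq ι] in
/-- `S₀ (Σ_{j∈F} c_j b_j) = Σ_{j∈F} (d_j c_j) b_j` for the diagonal `S₀ = diag(d)`. -/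
theorem diagonalCLM_sum_smul (d : lp (fun _ : ι => 𝕜) ⊤) (F : Finset ι) (c : ι → 𝕜) :
    b.diagonalCLM d (∑ j ∈ F, c j • b j) = ∑ j ∈ F, (d j * c j) • b j := by
  rw [map_sum]
  refine Finset.sum_congr rfl fun j _ => ?_
  rw [map_smul, b.diagonalCLM_basis, smul_smul, mul_comm]

omit [CompleteSpace H] [DecidableEq ι] in
/-- **`⟪T w_F, S₀ w_F⟫` in coordinates**: for `w_F = Σ_{j∈F} c_j b_j`,
`⟪T w_F, S₀ w_F⟫ = Σ_{i∈F} conj(Σ_{j∈F} ⟪b i, T b_j⟫ c_j) · (d_i c_i)`. -/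
theorem inner_map_diagonal_sum_smul (d : lp (fun _ : ι => 𝕜) ⊤) (T : H →L[𝕜] H) (F : Finset ι)
    (c : ι → 𝕜) :
    ⟪T (∑ j ∈ F, c j • b j), b.diagonalCLM d (∑ j ∈ F, c j • b j)⟫_𝕜 =
      ∑ i ∈ F, conj (∑ j ∈ F, ⟪b i, T (b j)⟫_𝕜 * c j) * (d i * c i) := by
  rw [diagonalCLM_sum_smul b d F c, inner_sum]
  refine Finset.sum_congr rfl fun i _ => ?_
  rw [inner_smul_right, ← inner_conj_symm, inner_basis_map_sum_smul b T F c i, mul_comm]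

omit [CompleteSpace H] in
/-- `‖S₀ w_F‖² = Σ_{i∈F} |d_i c_i|²` for `w_F = Σ_{j∈F} c_j b_j`. -/
theorem norm_sq_diagonal_sum_smul (d : lp (fun _ : ι => 𝕜) ⊤) (F : Finset ι) (c : ι → 𝕜) :
    ‖b.diagonalCLM d (∑ j ∈ F, c j • b j)‖ ^ 2 = ∑ i ∈ F, ‖d i * c i‖ ^ 2 := by
  rw [diagonalCLM_sum_smul b d F c, SkewCutGalerkinSections.norm_sq_sum_smul_basis b F]

/-! ## §2 `hpair` from sections -/

omit [CompleteSpace H] [DecidableEq ι] in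
/-- The coordinate pairing on a truncation equals the SECTION form of the first-order matrix:
with `t_ij = a_ij d_j` and `e_i = d_i c_i`,
`⟪T w_F, S₀ w_F⟫ = conj (Σ_{i∈F} Σ_{j∈F} conj(e_i) a_ij e_j)`. -/
theorem inner_map_diagonal_sum_smul_eq_conj_section (d : lp (fun _ : ι => 𝕜) ⊤)
    (t a : ι → ι → 𝕜) (hta : ∀ i j, t i j = a i j * d j) (T : H →L[𝕜] H)
    (hTt : ∀ i j, ⟪b i, T (b j)⟫_𝕜 = t i j) (F : Finset ι) (c : ι → 𝕜) :
    ⟪T (∑ j ∈ F, c j • b j), b.diagonalCLM d (∑ j ∈ F, c j • b j)⟫_𝕜 =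
      conj (∑ i ∈ F, ∑ j ∈ F, conj (d i * c i) * a i j * (d j * c j)) := by
  rw [inner_map_diagonal_sum_smul b d T F c, map_sum]
  refine Finset.sum_congr rfl fun i _ => ?_
  rw [map_sum, map_sum, Finset.sum_mul]
  refine Finset.sum_congr rfl fun j _ => ?_
  simp only [map_mul, starRingEnd_self_apply, hTt, hta]
  ring

omit [CompleteSpace H] in
/-- **`hpair` FROM SECTIONS.** In the diagonal / Hilbert-basis setting (`S₀ = diag(d)`), let the
bounded `T` have matrix `⟪b i, T b j⟫ = t_ij = a_ij d_j` (so `a` is the first-order matrix,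
`T = A S₀`). If every finite SECTION of `a` has real numerical range `≤ s`,
`Re Σ_{i∈F} Σ_{j∈F} conj(e_i) a_ij e_j ≤ s Σ_{i∈F} |e_i|²` for all finite `F` and all `e`, then
`Re ⟪T w, S₀ w⟫ ≤ s ‖S₀ w‖²` for EVERY `w ∈ H` — the strain-type pairing hypothesis `hpair` of
`BorderedEigenpairFromSections.certified_eigenpair_of_sections_nested`,
`ResolventFromSections.resolvent_inverse_of_sections` and
`SkewCutGalerkinTailForm.not_eigenvalue_of_structure`. (Truncate, compute in coordinates, pass
to the limit by continuity.) -/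
theorem re_inner_map_diagonal_le_of_sections (d : lp (fun _ : ι => 𝕜) ⊤) (t a : ι → ι → 𝕜)
    (hta : ∀ i j, t i j = a i j * d j) {s : ℝ}
    (hA : ∀ (F : Finset ι) (e : ι → 𝕜),
      RCLike.re (∑ i ∈ F, ∑ j ∈ F, conj (e i) * a i j * e j) ≤ s * ∑ i ∈ F, ‖e i‖ ^ 2)
    (T : H →L[𝕜] H) (hTt : ∀ i j, ⟪b i, T (b j)⟫_𝕜 = t i j) (w : H) :
    RCLike.re ⟪T w, b.diagonalCLM d w⟫_𝕜 ≤ s * ‖b.diagonalCLM d w‖ ^ 2 := by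
  set S₀ : H →L[𝕜] H := b.diagonalCLM d with hS₀
  -- the continuous functional `Q w = s ‖S₀ w‖² − Re ⟪T w, S₀ w⟫`
  set Q : H → ℝ := fun x => s * ‖S₀ x‖ ^ 2 - RCLike.re ⟪T x, S₀ x⟫_𝕜 with hQ
  have hQc : Continuous Q := by
    have h1 : Continuous fun x => ⟪T x, S₀ x⟫_𝕜 := T.continuous.inner S₀.continuous
    have h2 : Continuous fun x => ‖S₀ x‖ ^ 2 := S₀.continuous.norm.pow 2
    exact (continuous_const.mul h2).sub (RCLike.continuous_re.comp h1)
  -- `Q ≥ 0` on every truncation, by `hA` with `e_i = d_i ⟪b i, w⟫`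
  have hF : ∀ F : Finset ι, 0 ≤ Q (∑ j ∈ F, b.repr w j • b j) := by
    intro F
    have hAF := hA F fun i => d i * b.repr w i
    have hre : RCLike.re ⟪T (∑ j ∈ F, b.repr w j • b j), S₀ (∑ j ∈ F, b.repr w j • b j)⟫_𝕜 =
        RCLike.re (∑ i ∈ F, ∑ j ∈ F,
          conj (d i * b.repr w i) * a i j * (d j * b.repr w j)) := by
      rw [hS₀, inner_map_diagonal_sum_smul_eq_conj_section b d t a hta T hTt F, RCLike.conj_re]
    have hnorm : ‖S₀ (∑ j ∈ F, b.repr w j • b j)‖ ^ 2 = ∑ i ∈ F, ‖d i * b.repr w i‖ ^ 2 := by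
      classical
      exact norm_sq_diagonal_sum_smul b d F _
    simp only [hQ, hre, hnorm, sub_nonneg]
    exact hAF
  -- pass to the limit `w_F → w`
  have hlim : Tendsto (fun F : Finset ι => ∑ j ∈ F, b.repr w j • b j) atTop (𝓝 w) :=
    b.hasSum_repr w
  have h0 : 0 ≤ Q w := ge_of_tendsto' ((hQc.tendsto w).comp hlim) hF
  simp only [hQ, sub_nonneg] at h0
  exact h0

omit [CompleteSpace H] in
/-- `hpair` from sections, in the shape the three consumers quantify over (`∀ T` with the matrix,
band formula ignored, `∀ w` in the tail `U_Kᗮ`). -/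
theorem hpair_of_sections (d : lp (fun _ : ι => 𝕜) ⊤) (t a : ι → ι → 𝕜)
    (hta : ∀ i j, t i j = a i j * d j) {s : ℝ}
    (hA : ∀ (F : Finset ι) (e : ι → 𝕜),
      RCLike.re (∑ i ∈ F, ∑ j ∈ F, conj (e i) * a i j * e j) ≤ s * ∑ i ∈ F, ‖e i‖ ^ 2)
    (nbr : ι → Finset ι) (K : Finset ι) :
    ∀ T : H →L[𝕜] H, (∀ i j, ⟪b i, T (b j)⟫_𝕜 = t i j) →
      (∀ (i : ι) (x : H), ⟪b i, T x⟫_𝕜 = ∑ j ∈ nbr i, t i j * ⟪b j, x⟫_𝕜) →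
      ∀ w ∈ ((span 𝕜 (b '' (K : Set ι))).topologicalClosure)ᗮ,
        RCLike.re ⟪T w, b.diagonalCLM d w⟫_𝕜 ≤ s * ‖b.diagonalCLM d w‖ ^ 2 :=
  fun T hTt _ w _ => re_inner_map_diagonal_le_of_sections b d t a hta hA T hTt w

omit [CompleteSpace H] [DecidableEq ι] in
/-- The two-sided form in which the model's bound is printed (`|Re Σ| ≤ s Σ`, instab4's
`abs_re_sum_inner_crossForm_le` after the basis bookkeeping of §3) gives the one-sided section
hypothesis `hA`. -/
theorem sections_re_le_of_abs_le (a : ι → ι → 𝕜) {s : ℝ}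
    (hA : ∀ (F : Finset ι) (e : ι → 𝕜),
      |RCLike.re (∑ i ∈ F, ∑ j ∈ F, conj (e i) * a i j * e j)| ≤ s * ∑ i ∈ F, ‖e i‖ ^ 2)
    (F : Finset ι) (e : ι → 𝕜) :
    RCLike.re (∑ i ∈ F, ∑ j ∈ F, conj (e i) * a i j * e j) ≤ s * ∑ i ∈ F, ‖e i‖ ^ 2 :=
  le_of_abs_le (hA F e)

omit [CompleteSpace H] [DecidableEq ι] in
/-- With the free resolvent symbol `d_j (x₀ − ℓ_j) = 1`, the first-order matrix
`a_ij := t_ij (x₀ − ℓ_j)` of the consumers satisfies `t_ij = a_ij d_j`. -/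
theorem matrix_eq_firstOrder_mul_symbol (ℓ : ι → ℝ) (x₀ : ℝ) (d : lp (fun _ : ι => 𝕜) ⊤)
    (hd : ∀ i, d i * ((x₀ : 𝕜) - (ℓ i : 𝕜)) = 1) (t : ι → ι → 𝕜) (i j : ι) :
    t i j = t i j * ((x₀ : 𝕜) - (ℓ j : 𝕜)) * d j := by
  rw [mul_assoc, mul_comm ((x₀ : 𝕜) - (ℓ j : 𝕜)), hd j, mul_one]


/-! ## §3 Lattice side: from a pointwise-linear `X` on orthonormal families to the section form -/

section Lattice

variable {K E : Type*} [NormedAddCommGroup E] [InnerProductSpace 𝕜 E]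

omit [DecidableEq ι] in
/-- Pointwise expansion:
`⟪Σ_{i∈F} e_i v_i(k), Σ_{j∈F} e_j w_j(k)⟫ = Σ_i Σ_j conj(e_i) ⟪v_i(k), w_j(k)⟫ e_j`. -/
theorem inner_sum_smul_sum_smul (v w : ι → K → E) (F : Finset ι) (e : ι → 𝕜) (k : K) :
    ⟪∑ i ∈ F, e i • v i k, ∑ j ∈ F, e j • w j k⟫_𝕜 =
      ∑ i ∈ F, ∑ j ∈ F, conj (e i) * ⟪v i k, w j k⟫_𝕜 * e j := by
  rw [sum_inner]
  refine Finset.sum_congr rfl fun i _ => ?_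
  rw [inner_sum]
  refine Finset.sum_congr rfl fun j _ => ?_
  rw [inner_smul_left, inner_smul_right]
  ring

omit [DecidableEq ι] in
/-- **Gram bookkeeping for the pairing** (the shape of instab4's lattice operator `X`:
pointwise, linear on finite combinations). For families `v_i : K → E`, `X` with
`X(Σ_{j∈F} e_j v_j)(k) = Σ_{j∈F} e_j X(v_j)(k)`, and matrix entries
`a_ij = Σ'_k ⟪v_i(k), X(v_j)(k)⟫` (as `HasSum`): for `c = Σ_{i∈F} e_i v_i`,
`HasSum (k ↦ ⟪c(k), X(c)(k)⟫) (Σ_{i∈F} Σ_{j∈F} conj(e_i) a_ij e_j)` — the left member of `hA`. -/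
theorem hasSum_inner_apply_of_matrix (v : ι → K → E) (X : (K → E) → (K → E))
    (hX : ∀ (F : Finset ι) (e : ι → 𝕜) (k : K),
      X (fun k => ∑ j ∈ F, e j • v j k) k = ∑ j ∈ F, e j • X (v j) k)
    (a : ι → ι → 𝕜) (ha : ∀ i j, HasSum (fun k => ⟪v i k, X (v j) k⟫_𝕜) (a i j))
    (F : Finset ι) (e : ι → 𝕜) :
    HasSum (fun k => ⟪∑ i ∈ F, e i • v i k, X (fun k => ∑ j ∈ F, e j • v j k) k⟫_𝕜)
      (∑ i ∈ F, ∑ j ∈ F, conj (e i) * a i j * e j) := by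
  have h : ∀ k, ⟪∑ i ∈ F, e i • v i k, X (fun k => ∑ j ∈ F, e j • v j k) k⟫_𝕜 =
      ∑ i ∈ F, ∑ j ∈ F, conj (e i) * ⟪v i k, X (v j) k⟫_𝕜 * e j := fun k => by
    rw [hX F e k, inner_sum_smul_sum_smul]
  simp_rw [h]
  exact hasSum_sum fun i _ => hasSum_sum fun j _ => ((ha i j).mul_left _).mul_right _

/-- **Gram bookkeeping for the norm**: orthonormal families in the pointwise presentation,
`HasSum (k ↦ ⟪v_i(k), v_j(k)⟫) δ_ij`, give
`HasSum (k ↦ ‖Σ_{i∈F} e_i v_i(k)‖²) (Σ_{i∈F} |e_i|²)` — the right member of `hA`. -/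
theorem hasSum_norm_sq_sum_smul (v : ι → K → E)
    (hv : ∀ i j, HasSum (fun k => ⟪v i k, v j k⟫_𝕜) (if i = j then 1 else 0))
    (F : Finset ι) (e : ι → 𝕜) :
    HasSum (fun k => ‖∑ i ∈ F, e i • v i k‖ ^ 2) (∑ i ∈ F, ‖e i‖ ^ 2) := by
  have h1 : HasSum (fun k => ⟪∑ i ∈ F, e i • v i k, ∑ j ∈ F, e j • v j k⟫_𝕜)
      (∑ i ∈ F, ∑ j ∈ F, conj (e i) * (if i = j then (1 : 𝕜) else 0) * e j) := by
    have h : ∀ k, ⟪∑ i ∈ F, e i • v i k, ∑ j ∈ F, e j • v j k⟫_𝕜 =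
        ∑ i ∈ F, ∑ j ∈ F, conj (e i) * ⟪v i k, v j k⟫_𝕜 * e j := fun k =>
      inner_sum_smul_sum_smul v v F e k
    simp_rw [h]
    exact hasSum_sum fun i _ => hasSum_sum fun j _ => ((hv i j).mul_left _).mul_right _
  have h2 : (∑ i ∈ F, ∑ j ∈ F, conj (e i) * (if i = j then (1 : 𝕜) else 0) * e j) =
      ((∑ i ∈ F, ‖e i‖ ^ 2 : ℝ) : 𝕜) := by
    push_cast
    refine Finset.sum_congr rfl fun i hi => ?_
    rw [Finset.sum_eq_single i (fun j _ hji => by rw [if_neg (Ne.symm hji), mul_zero, zero_mul])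
      (fun h => (h hi).elim), if_pos rfl, mul_one, RCLike.conj_mul]
  rw [h2] at h1
  have h3 := h1.mapL RCLike.reCLM
  simp only [RCLike.reCLM_apply, RCLike.ofReal_re] at h3
  have h4 : (fun k => RCLike.re ⟪∑ i ∈ F, e i • v i k, ∑ j ∈ F, e j • v j k⟫_𝕜) =
      fun k => ‖∑ i ∈ F, e i • v i k‖ ^ 2 :=
    funext fun k => inner_self_eq_norm_sq (𝕜 := 𝕜) (∑ i ∈ F, e i • v i k)
  rwa [h4] at h3

/-- **The section hypothesis `hA` from a pointwise pairing bound.** If `X` is pointwise-linear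
on finite combinations of the orthonormal families `v_i`, `a_ij = Σ'_k ⟪v_i(k), X(v_j)(k)⟫`, and
the model bound `Re Σ'_k ⟪c(k), X(c)(k)⟫ ≤ s Σ'_k ‖c(k)‖²` holds for every finite combination
`c = Σ_{i∈F} e_i v_i`, then every finite section of `a` has real numerical range `≤ s`. -/
theorem sections_re_le_of_pointwise (v : ι → K → E)
    (hv : ∀ i j, HasSum (fun k => ⟪v i k, v j k⟫_𝕜) (if i = j then 1 else 0))
    (X : (K → E) → (K → E))
    (hX : ∀ (F : Finset ι) (e : ι → 𝕜) (k : K),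
      X (fun k => ∑ j ∈ F, e j • v j k) k = ∑ j ∈ F, e j • X (v j) k)
    (a : ι → ι → 𝕜) (ha : ∀ i j, HasSum (fun k => ⟪v i k, X (v j) k⟫_𝕜) (a i j)) {s : ℝ}
    (hmodel : ∀ (F : Finset ι) (e : ι → 𝕜),
      RCLike.re (∑' k, ⟪∑ i ∈ F, e i • v i k, X (fun k => ∑ j ∈ F, e j • v j k) k⟫_𝕜) ≤
        s * ∑' k, ‖∑ i ∈ F, e i • v i k‖ ^ 2)
    (F : Finset ι) (e : ι → 𝕜) :
    RCLike.re (∑ i ∈ F, ∑ j ∈ F, conj (e i) * a i j * e j) ≤ s * ∑ i ∈ F, ‖e i‖ ^ 2 := by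
  rw [← (hasSum_inner_apply_of_matrix v X hX a ha F e).tsum_eq,
    ← (hasSum_norm_sq_sum_smul v hv F e).tsum_eq]
  exact hmodel F e

end Lattice

/-! ## §4 The GROUP-B END-TO-END theorems with `hpair` replaced by the section hypothesis -/

/-- **THEOREM 3-B-NESTED END-TO-END FROM MATRIX DATA, pairing from sections.**
`BorderedEigenpairFromSections.certified_eigenpair_of_sections_nested` (p465285) with its one
operator-form hypothesis `hpair` replaced by «every finite section of the first-order matrix
`a_ij = t_ij (x₀ − ℓ_j)` has real numerical range `≤ s`» (all other hypotheses and the conclusion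
verbatim). -/
theorem certified_eigenpair_of_sections_nested_of_sections
    (ℓ : ι → ℝ) (x₀ : ℝ) (d : lp (fun _ : ι => 𝕜) ⊤) (hd : ∀ i, d i * ((x₀ : 𝕜) - (ℓ i : 𝕜)) = 1)
    (hd0 : Tendsto (fun i => ‖d i‖) cofinite (𝓝 0))
    (t : ι → ι → 𝕜) {R₀ C₀ : ℝ} (hrow : ∀ i, Summable fun j => ‖t i j‖)
    (hR : ∀ i, ∑' j, ‖t i j‖ ≤ R₀) (hcol : ∀ j, Summable fun i => ‖t i j‖)
    (hC₀ : ∀ j, ∑' i, ‖t i j‖ ≤ C₀) (hR0 : 0 ≤ R₀) (hC0 : 0 ≤ C₀) (hq : R₀ * C₀ < 1)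
    (nbr : ι → Finset ι) (hsymm : ∀ i j, j ∈ nbr i ↔ i ∈ nbr j)
    (ht0 : ∀ i j, j ∉ nbr i → t i j = 0)
    (lt : 𝕜) (K Kv : Finset ι) (vt : ι → 𝕜) (hvt0 : ∀ i, i ∉ Kv → vt i = 0)
    {r₀ nt : ℝ} (hr₀ : 0 ≤ r₀) (hnt : 0 ≤ nt)
    (hres : ∑ i ∈ Kv ∪ Kv.biUnion nbr, ‖(if i ∈ Kv then (lt - (ℓ i : 𝕜)) * vt i else 0) -
        ∑ j ∈ Kv, (t i j * ((x₀ : 𝕜) - (ℓ j : 𝕜))) * vt j‖ ^ 2 ≤ r₀ ^ 2)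
    (hntb : ∑ i ∈ Kv \ K, ‖vt i‖ ^ 2 ≤ nt ^ 2)
    (Binv : ((K → 𝕜) × 𝕜) →ₗ[𝕜] ((K → 𝕜) × 𝕜))
    (hBinv : ∀ (c : K → 𝕜) (m : 𝕜),
      Binv (fun i : K => (lt - (ℓ i : 𝕜)) * c i -
          ∑ j : K, (t i j * ((x₀ : 𝕜) - (ℓ j : 𝕜))) * c j + m * vt i,
        ∑ i : K, conj (vt i) * c i) = (c, m))
    {α βB βC gB : ℝ} (hα : 0 ≤ α) (hβB : 0 ≤ βB) (hβC : 0 ≤ βC) (hgB : 0 ≤ gB)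
    (hαM : ∀ (c : K → 𝕜) (g : 𝕜),
      ∑ j : K, ‖(Binv (c, g)).1 j‖ ^ 2 + ‖(Binv (c, g)).2‖ ^ 2 ≤
        α ^ 2 * (∑ i : K, ‖c i‖ ^ 2 + ‖g‖ ^ 2))
    (hβBM : ∀ e : ι → 𝕜,
      ∑ j : K, ‖(Binv (fun i : K => -∑ j ∈ nbr i \ K,
          (t i j * ((x₀ : 𝕜) - (ℓ j : 𝕜))) * e j, 0)).1 j‖ ^ 2 +
        ‖(Binv (fun i : K => -∑ j ∈ nbr i \ K,
          (t i j * ((x₀ : 𝕜) - (ℓ j : 𝕜))) * e j, 0)).2‖ ^ 2 ≤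
        βB ^ 2 * ∑ j ∈ K.biUnion nbr \ K, ‖e j‖ ^ 2)
    (hβCM : ∀ (c : K → 𝕜) (g : 𝕜),
      ∑ i ∈ (K.biUnion nbr ∪ Kv) \ K,
        ‖-∑ j : K, (t i j * ((x₀ : 𝕜) - (ℓ j : 𝕜))) * (Binv (c, g)).1 j +
          (Binv (c, g)).2 * vt i‖ ^ 2 ≤ βC ^ 2 * (∑ i : K, ‖c i‖ ^ 2 + ‖g‖ ^ 2))
    (hgBM : ∀ e : ι → 𝕜,
      ‖(Binv (fun i : K => ∑ j ∈ nbr i \ K, (t i j * ((x₀ : 𝕜) - (ℓ j : 𝕜))) * e j, 0)).2‖ ^ 2 ≤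
        gB ^ 2 * ∑ j ∈ K.biUnion nbr \ K, ‖e j‖ ^ 2)
    {s MU2 μ M : ℝ} (sh : Finset ι)
    (hshellM : ∀ e : ι → 𝕜, (∀ i ∈ K, e i = 0) →
      MU2 * ∑ i ∈ sh, ‖e i‖ ^ 2 ≤ ∑ i ∈ sh, (RCLike.re lt - ℓ i - s) * ‖e i‖ ^ 2 -
        RCLike.re (∑ i ∈ K.biUnion nbr \ K,
          conj (∑ j : K, (t i j * ((x₀ : 𝕜) - (ℓ j : 𝕜))) *
            (Binv (fun i : K => ∑ j ∈ nbr i \ K, (t i j * ((x₀ : 𝕜) - (ℓ j : 𝕜))) * e j, 0)).1 j) *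
          e i))
    (htail : ∀ i, i ∉ K → i ∉ sh → MU2 ≤ RCLike.re lt - ℓ i - s)
    (hμdef : μ = MU2 - gB * nt) (hμ : 0 < μ)
    (hMdef : M = √((1 + βC ^ 2) / μ ^ 2 + (α + βB * √(1 + βC ^ 2) / μ) ^ 2))
    (hκ : 2 * Real.sqrt 2 * M ^ 2 * r₀ < 1)
    -- the pairing bound ON SECTIONS of the first-order matrix `a_ij = t_ij (x₀ − ℓ_j)`
    (hA : ∀ (F : Finset ι) (e : ι → 𝕜),
      RCLike.re (∑ i ∈ F, ∑ j ∈ F, conj (e i) * (t i j * ((x₀ : 𝕜) - (ℓ j : 𝕜))) * e j) ≤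
        s * ∑ i ∈ F, ‖e i‖ ^ 2) :
    ∃ T : H →L[𝕜] H, (∀ i j, ⟪b i, T (b j)⟫_𝕜 = t i j) ∧ ‖T‖ ≤ Real.sqrt (R₀ * C₀) ∧
    ∃ lam : 𝕜, ∃ ws : H,
      (((1 : H →L[𝕜] H) - T - ((x₀ : 𝕜) - lam) • b.diagonalCLM d) ws = 0 ∧
        ‖b.diagonalCLM d ws - ∑ j ∈ Kv, vt j • b j‖ ^ 2 + ‖lam - lt‖ ^ 2 ≤ (2 * M * r₀) ^ 2 ∧
        ⟪∑ i ∈ K, vt i • b i, b.diagonalCLM d ws⟫_𝕜 = ⟪∑ i ∈ K, vt i • b i, ∑ j ∈ Kv, vt j • b j⟫_𝕜) ∧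
      (∀ (lam' : 𝕜) (w' : H), ((1 : H →L[𝕜] H) - T - ((x₀ : 𝕜) - lam') • b.diagonalCLM d) w' = 0 →
        ‖b.diagonalCLM d w' - ∑ j ∈ Kv, vt j • b j‖ ^ 2 + ‖lam' - lt‖ ^ 2 ≤ (2 * M * r₀) ^ 2 →
        ⟪∑ i ∈ K, vt i • b i, b.diagonalCLM d w'⟫_𝕜 = ⟪∑ i ∈ K, vt i • b i, ∑ j ∈ Kv, vt j • b j⟫_𝕜 →
        lam' = lam ∧ w' = ws) ∧
      (∀ y : H, ((1 : H →L[𝕜] H) - T - ((x₀ : 𝕜) - lam) • b.diagonalCLM d) y = 0 →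
        y = (⟪∑ i ∈ K, vt i • b i, b.diagonalCLM d y⟫_𝕜 /
          ⟪∑ i ∈ K, vt i • b i, b.diagonalCLM d ws⟫_𝕜) • ws) ∧
      (∀ y₁ y₂ : H, ((1 : H →L[𝕜] H) - T - ((x₀ : 𝕜) - lam) • b.diagonalCLM d) y₁ =
          b.diagonalCLM d y₂ →
        ((1 : H →L[𝕜] H) - T - ((x₀ : 𝕜) - lam) • b.diagonalCLM d) y₂ = 0 → y₂ = 0) ∧
      (∀ z : 𝕜, z ≠ lam → ‖z - lam‖ < (1 - 2 * Real.sqrt 2 * M ^ 2 * r₀) / M →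
        IsUnit ((1 : H →L[𝕜] H) - T - ((x₀ : 𝕜) - z) • b.diagonalCLM d)) :=
  BorderedEigenpairFromSections.certified_eigenpair_of_sections_nested b ℓ x₀ d hd hd0 t hrow hR
    hcol hC₀ hR0 hC0 hq nbr hsymm ht0 lt K Kv vt hvt0 hr₀ hnt hres hntb Binv hBinv hα hβB hβC hgB
    hαM hβBM hβCM hgBM sh hshellM htail hμdef hμ hMdef hκ
    (hpair_of_sections b d t (fun i j => t i j * ((x₀ : 𝕜) - (ℓ j : 𝕜)))
      (matrix_eq_firstOrder_mul_symbol ℓ x₀ d hd t) hA nbr K)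

/-- **THEOREM R (RESOLVENT / NON-RESONANCE CERTIFICATE) END-TO-END FROM MATRIX DATA, pairing from
sections.** `ResolventFromSections.resolvent_inverse_of_sections` (p466288) with its one
operator-form hypothesis `hpair` replaced by the section hypothesis on `a_ij = t_ij (x₀ − ℓ_j)`
(all other hypotheses and the conclusion verbatim). -/
theorem resolvent_inverse_of_sections_of_sections
    (ℓ : ι → ℝ) (x₀ : ℝ) (d : lp (fun _ : ι => 𝕜) ⊤) (hd : ∀ i, d i * ((x₀ : 𝕜) - (ℓ i : 𝕜)) = 1)
    (hd0 : Tendsto (fun i => ‖d i‖) cofinite (𝓝 0))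
    (t : ι → ι → 𝕜) {R₀ C₀ : ℝ} (hrow : ∀ i, Summable fun j => ‖t i j‖)
    (hR : ∀ i, ∑' j, ‖t i j‖ ≤ R₀) (hcol : ∀ j, Summable fun i => ‖t i j‖)
    (hC₀ : ∀ j, ∑' i, ‖t i j‖ ≤ C₀) (hR0 : 0 ≤ R₀) (hC0 : 0 ≤ C₀) (hq : R₀ * C₀ < 1)
    (nbr : ι → Finset ι) (hsymm : ∀ i j, j ∈ nbr i ↔ i ∈ nbr j)
    (ht0 : ∀ i j, j ∉ nbr i → t i j = 0)
    (z : 𝕜) (K : Finset ι) (Binv : (K → 𝕜) →ₗ[𝕜] (K → 𝕜))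
    (hBinv : ∀ c : K → 𝕜, Binv (fun i : K => (z - (ℓ i : 𝕜)) * c i -
      ∑ j : K, (t i j * ((x₀ : 𝕜) - (ℓ j : 𝕜))) * c j) = c)
    {α βB βC : ℝ} (hα : 0 ≤ α) (hβB : 0 ≤ βB) (hβC : 0 ≤ βC)
    (hαM : ∀ c : K → 𝕜, ∑ j : K, ‖Binv c j‖ ^ 2 ≤ α ^ 2 * ∑ i : K, ‖c i‖ ^ 2)
    (hβBM : ∀ e : ι → 𝕜, ∑ j : K, ‖Binv (fun i : K => -∑ j ∈ nbr i \ K,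
        (t i j * ((x₀ : 𝕜) - (ℓ j : 𝕜))) * e j) j‖ ^ 2 ≤
        βB ^ 2 * ∑ j ∈ K.biUnion nbr \ K, ‖e j‖ ^ 2)
    (hβCM : ∀ c : K → 𝕜, ∑ i ∈ K.biUnion nbr \ K,
      ‖∑ j : K, (t i j * ((x₀ : 𝕜) - (ℓ j : 𝕜))) * Binv c j‖ ^ 2 ≤ βC ^ 2 * ∑ i : K, ‖c i‖ ^ 2)
    {s MU2 : ℝ} (hMU2 : 0 < MU2) (sh : Finset ι)
    (hshellM : ∀ e : ι → 𝕜, (∀ i ∈ K, e i = 0) →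
      MU2 * ∑ i ∈ sh, ‖e i‖ ^ 2 ≤ ∑ i ∈ sh, (RCLike.re z - ℓ i - s) * ‖e i‖ ^ 2 -
        RCLike.re (∑ i ∈ K.biUnion nbr \ K,
          conj (∑ j : K, (t i j * ((x₀ : 𝕜) - (ℓ j : 𝕜))) *
            Binv (fun i : K => ∑ j ∈ nbr i \ K, (t i j * ((x₀ : 𝕜) - (ℓ j : 𝕜))) * e j) j) *
          e i))
    (htail : ∀ i, i ∉ K → i ∉ sh → MU2 ≤ RCLike.re z - ℓ i - s)
    -- the pairing bound ON SECTIONS of the first-order matrix `a_ij = t_ij (x₀ − ℓ_j)`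
    (hA : ∀ (F : Finset ι) (e : ι → 𝕜),
      RCLike.re (∑ i ∈ F, ∑ j ∈ F, conj (e i) * (t i j * ((x₀ : 𝕜) - (ℓ j : 𝕜))) * e j) ≤
        s * ∑ i ∈ F, ‖e i‖ ^ 2) :
    ∃ T : H →L[𝕜] H, (∀ i j, ⟪b i, T (b j)⟫_𝕜 = t i j) ∧ ‖T‖ ≤ Real.sqrt (R₀ * C₀) ∧
    ∃ Rinv : H →L[𝕜] H,
      (∀ f, ((1 : H →L[𝕜] H) - T - ((x₀ : 𝕜) - z) • b.diagonalCLM d) (Rinv f) = f) ∧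
      (∀ w, Rinv (((1 : H →L[𝕜] H) - T - ((x₀ : 𝕜) - z) • b.diagonalCLM d) w) = w) ∧
      ‖b.diagonalCLM d ∘L Rinv‖ ≤
        √((1 + βC ^ 2) / MU2 ^ 2 + (α + βB * √(1 + βC ^ 2) / MU2) ^ 2) ∧
      ∀ f, ‖b.diagonalCLM d (Rinv f)‖ ≤
        √((1 + βC ^ 2) / MU2 ^ 2 + (α + βB * √(1 + βC ^ 2) / MU2) ^ 2) * ‖f‖ :=
  ResolventFromSections.resolvent_inverse_of_sections b ℓ x₀ d hd hd0 t hrow hR hcol hC₀ hR0 hC0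
    hq nbr hsymm ht0 z K Binv hBinv hα hβB hβC hαM hβBM hβCM hMU2 sh hshellM htail
    (hpair_of_sections b d t (fun i j => t i j * ((x₀ : 𝕜) - (ℓ j : 𝕜)))
      (matrix_eq_firstOrder_mul_symbol ℓ x₀ d hd t) hA nbr K)

end Summit.NavierStokesRegularity.FluidComputer.BorderedEigenpairPairingSections

end
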